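import Literature.Computability.Complexity.FKPointLocationChecksFP
import Literature.Computability.Complexity.FKPointLocationXStar
import Literature.Computability.Complexity.FKPointLocationParams
import HarnessLib

/-!
# Fournier–Koiran point location, XVI: the located point and the level parameters are polynomial-time

Topic `Literature/Computability/Complexity`, grouping namespace `FKPointLocation`. Two more typed
polynomial-time programs (`CodeFP`) of the location procedure of Fournier–Koiran (ICALP 2000 = LIP
RR-1999-21):

* **`uxsOfFP`** — the located rational point in homogeneous integer coordinates
  (`FKPointLocationXStar.uxsOf`: one pass of integer arithmetic over the level records, the report's
  "rational point `q ∈ P_S` with small coordinates", p. 11) from `(P, 1ᵁ, levels)`: a left fold whose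
  accumulator grows additively in bit size per level (`xsBnd_uxsStep`, `xsBnd_foldl`);
* **`paramsOfFP`** — the level parameters `paramsOf n (T(n)+1)` (`FKPointLocationParams.lean`: `D = n+1`,
  `B = 2^{T(n)+1}`, `κ`, `L`, `W` explicit polynomials in `n` and `T(n)`) as the unary record
  `paramsE` computed from `1ⁿ` (unary arithmetic; `T(n)` by `Plumb.polyFn`), together with the binary
  coefficient bound `2^{T(n)+1}` (`boundOfFP`).

## References

* H. Fournier, P. Koiran, *Lower bounds are not easier over the reals: inside PH*, ICALP 2000,
  LNCS 1853 = LIP RR-1999-21, §2.1 (`r_n`), §2.2 (polynomial sizes), p. 11. [FournierKoiran2000]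
* S. Arora, B. Barak, *Computational Complexity: A Modern Approach*, CUP 2009, §1.3. [AroraBarak2009]
-/

namespace Literature.Computability.Complexity

namespace FKPointLocation

open _root_.Computability CodeFP Polynomial

/-! ### The un-projection pass -/

section XStar

/-- The input of one un-projection step: `((P, 1ᵁ), isZero, r, (N, R))`. [folklore] -/
private abbrev XIn : Type := (UParams × ℕ) × Bool × ULevelRec × (List ℤ × ℕ)

/-- Its code (`U` in unary). [folklore] -/
private abbrev xinE : XIn → List Bool := pairE (pairE paramsE unE) (pairE bitE (pairE lrecE (pairE vecE natE)))

/-- **One un-projection step `uxsStep` is computed in polynomial time.** [cite: FournierKoiran2000, p. 11] -/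
theorem uxsStepFP : CodeFP xinE (pairE vecE natE) (fun q : XIn => uxsStep q.1.1 q.1.2 q.2.1 q.2.2.1 q.2.2.2) := by
  have hP : CodeFP xinE paramsE (fun q : XIn => q.1.1) := (fst _ _).fst'
  have hU : CodeFP xinE unE (fun q : XIn => q.1.2) := (fst _ _).snd'
  have hz : CodeFP xinE bitE (fun q : XIn => q.2.1) := (snd _ _).fst'
  have hr : CodeFP xinE lrecE (fun q : XIn => q.2.2.1) := (snd _ _).snd'.fst'
  have hN : CodeFP xinE vecE (fun q : XIn => q.2.2.2.1) := (snd _ _).snd'.snd'.fst'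
  have hR : CodeFP xinE intE (fun q : XIn => (q.2.2.2.2 : ℤ)) := (intOfNat.comp (snd _ _).snd'.snd'.snd' :)
  have hsc : CodeFP xinE unE (fun q : XIn => min q.2.2.1.sc q.1.2) := (unOfNatMin.comp (hU.pair (lrec_sc.comp hr)) :)
  have hmN : CodeFP xinE intE (fun q : XIn => if q.2.1 then (1 : ℤ) else 2 ^ (q.1.1.κ * (min q.2.2.1.sc q.1.2 + 1))) :=
    hz.ite (const xinE (1 : ℤ)) (intPow.comp ((const xinE (2 : ℤ)).pair (unMul.comp ((params_κ.comp hP).pair (unSucc.comp hsc)))) :)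
  have hmD : CodeFP xinE natE (fun q : XIn => if q.2.1 then 1 else 2 ^ (q.1.1.L + 5)) :=
    hz.ite (const xinE 1) (natPow.comp ((const xinE 2).pair ((unAdd.comp ((params_L.comp hP).pair (const xinE 5))) :)) :)
  have hd : CodeFP xinE intE (fun q : XIn => (q.2.2.1.apexD : ℤ)) := (intOfNat.comp (lrec_apexD.comp hr) :)
  -- the coordinates: `zipWith` with context `(R, mD, mN, d)`
  have hg : CodeFP (pairE (pairE intE (pairE intE (pairE intE intE))) (pairE intE intE)) intE
      (fun t => t.2.1 * t.1.1 * t.1.2.1 + t.1.2.2.1 * (t.2.2 * t.1.2.2.2 - t.2.1 * t.1.1)) :=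
    (intAdd.comp ((intMul.comp ((intMul.comp ((snd _ _).fst'.pair (fst _ _).fst')).pair (fst _ _).snd'.fst')).pair
      (intMul.comp ((fst _ _).snd'.snd'.fst'.pair (intSub.comp ((intMul.comp ((snd _ _).snd'.pair (fst _ _).snd'.snd'.snd')).pair
        (intMul.comp ((snd _ _).fst'.pair (fst _ _).fst'))))))) :)
  have hzw := (zipWith (g := fun t : (ℤ × ℤ × ℤ × ℤ) × ℤ × ℤ => t.2.1 * t.1.1 * t.1.2.1 + t.1.2.2.1 * (t.2.2 * t.1.2.2.2 - t.2.1 * t.1.1)) hg :)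
  have hctx : CodeFP xinE (pairE intE (pairE intE (pairE intE intE))) (fun q : XIn =>
      ((q.2.2.2.2 : ℤ), ((if q.2.1 then 1 else 2 ^ (q.1.1.L + 5) : ℕ) : ℤ),
        (if q.2.1 then (1 : ℤ) else 2 ^ (q.1.1.κ * (min q.2.2.1.sc q.1.2 + 1))), (q.2.2.1.apexD : ℤ))) :=
    (hR.pair ((intOfNat.comp hmD).pair (hmN.pair hd)) :)
  have hcoords := (hzw.comp (hctx.pair ((lrec_apexN.comp hr).pair hN)) :)
  have hden : CodeFP xinE natE (fun q : XIn => q.2.2.1.apexD * q.2.2.2.2 * (if q.2.1 then 1 else 2 ^ (q.1.1.L + 5))) :=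
    (natMul.comp ((natMul.comp ((lrec_apexD.comp hr).pair (snd _ _).snd'.snd'.snd')).pair hmD) :)
  exact ((hcoords.pair hden :)).congr fun q => by simp only [uxsStep]

/-- Size of the accumulator of the pass. [folklore] -/
def XsBnd (M : ℕ) (p : List ℤ × ℕ) : Prop := (∀ a ∈ p.1, a.natAbs < 2 ^ M) ∧ p.2 < 2 ^ M

/-- Size of a level record. [folklore] -/
def LrecBnd (A : ℕ) (r : ULevelRec) : Prop := (∀ a ∈ r.apexN, a.natAbs < 2 ^ A) ∧ r.apexD < 2 ^ A

/-- **Additive growth of one un-projection step**: from `XsBnd M p`, `LrecBnd A r`, `L + 5 ≤ E`,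
`κ (U + 1) ≤ E` to `XsBnd (M + A + E + 3) (uxsStep P U z r p)`, with at most as many coordinates.
[cite: FournierKoiran2000, §2.2] -/
theorem xsBnd_uxsStep (P : UParams) (U : ℕ) (z : Bool) (r : ULevelRec) (p : List ℤ × ℕ) {M A E : ℕ}
    (hp : XsBnd M p) (hr : LrecBnd A r) (hL : P.L + 5 ≤ E) (hκ : P.κ * (U + 1) ≤ E) :
    XsBnd (M + A + E + 3) (uxsStep P U z r p) ∧ (uxsStep P U z r p).1.length ≤ p.1.length := by
  have hmD : (if z then 1 else 2 ^ (P.L + 5) : ℕ) ≤ 2 ^ E := by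
    split_ifs
    · exact Nat.one_le_two_pow
    · exact Nat.pow_le_pow_right (by norm_num) hL
  have hmN : (if z then (1 : ℤ) else 2 ^ (P.κ * (min r.sc U + 1))).natAbs ≤ 2 ^ E := by
    split_ifs
    · simp [Nat.one_le_two_pow]
    · rw [Int.natAbs_pow]
      exact Nat.pow_le_pow_right (by norm_num) ((Nat.mul_le_mul_left _ (Nat.succ_le_succ (min_le_right _ _))).trans hκ)
  have hR : p.2 < 2 ^ M := hp.2
  have hd : r.apexD < 2 ^ A := hr.2
  refine ⟨⟨fun a ha => ?_, ?_⟩, ?_⟩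
  · simp only [uxsStep] at ha
    obtain ⟨σ, hσ, N, hN, rfl⟩ := exists_of_mem_zipWith ha
    have hσ' := hr.1 σ hσ
    have hN' := hp.1 N hN
    -- `|σ R mD| < 2^{A+M+E}` and `|mN (N d - σ R)| < 2^E (2^{M+A} + 2^{A+M})`
    have h1 : (σ * (p.2 : ℤ) * ((if z then 1 else 2 ^ (P.L + 5) : ℕ) : ℤ)).natAbs < 2 ^ (A + M + E) := by
      rw [Int.natAbs_mul, Int.natAbs_mul, Int.natAbs_natCast, Int.natAbs_natCast,
        show 2 ^ (A + M + E) = 2 ^ A * 2 ^ M * 2 ^ E by rw [pow_add, pow_add]]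
      exact Nat.mul_lt_mul_of_lt_of_le (Nat.mul_lt_mul'' hσ' hR) hmD (by positivity)
    have h2 : (N * (r.apexD : ℤ) - σ * (p.2 : ℤ)).natAbs < 2 ^ (A + M + 1) := by
      have e1 : (N * (r.apexD : ℤ)).natAbs < 2 ^ (A + M) := by
        rw [Int.natAbs_mul, Int.natAbs_natCast, pow_add, mul_comm (2 ^ A)]; exact Nat.mul_lt_mul'' hN' hd
      have e2 : (σ * (p.2 : ℤ)).natAbs < 2 ^ (A + M) := by
        rw [Int.natAbs_mul, Int.natAbs_natCast, pow_add]; exact Nat.mul_lt_mul'' hσ' hR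
      have := Int.natAbs_sub_le (N * (r.apexD : ℤ)) (σ * (p.2 : ℤ))
      rw [pow_succ]; omega
    have h3 : ((if z then (1 : ℤ) else 2 ^ (P.κ * (min r.sc U + 1))) * (N * (r.apexD : ℤ) - σ * (p.2 : ℤ))).natAbs < 2 ^ (A + M + E + 1) := by
      rw [Int.natAbs_mul, show A + M + E + 1 = E + (A + M + 1) by ring, pow_add]
      exact Nat.mul_lt_mul_of_le_of_lt hmN h2 (by positivity)
    exact natAbs_lt_mono (natAbs_add_lt (natAbs_lt_mono h1 (Nat.le_succ _)) h3) (by omega)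
  · show r.apexD * p.2 * (if z then 1 else 2 ^ (P.L + 5)) < 2 ^ (M + A + E + 3)
    calc r.apexD * p.2 * (if z then 1 else 2 ^ (P.L + 5)) < 2 ^ A * 2 ^ M * 2 ^ E :=
          Nat.mul_lt_mul_of_lt_of_le (Nat.mul_lt_mul'' hd hR) hmD (by positivity)
      _ ≤ 2 ^ (M + A + E + 3) := by
          rw [show M + A + E + 3 = A + M + E + 3 by ring, pow_add, pow_add, pow_add]
          exact Nat.le_mul_of_pos_right _ (by positivity)
  · simp only [uxsStep, List.length_zipWith]; exact min_le_right _ _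

/-- The bound along the fold. [cite: FournierKoiran2000, §2.2] -/
theorem xsBnd_foldl (P : UParams) (U : ℕ) {A E : ℕ} (hL : P.L + 5 ≤ E) (hκ : P.κ * (U + 1) ≤ E) (n : ℕ) :
    ∀ (l : List (ℕ × ULevelRec)) {M : ℕ} (p : List ℤ × ℕ), XsBnd M p → (∀ t ∈ l, LrecBnd A t.2) →
      XsBnd (M + l.length * (A + E + 3)) (l.foldl (fun q t => uxsStep P U (decide (t.1 + 1 = n)) t.2 q) p) ∧
        (l.foldl (fun q t => uxsStep P U (decide (t.1 + 1 = n)) t.2 q) p).1.length ≤ p.1.length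
  | [], M, p, hp, _ => by simpa using hp
  | t :: l, M, p, hp, hl => by
    rw [List.foldl_cons]
    obtain ⟨h1, hlen⟩ := xsBnd_uxsStep P U (decide (t.1 + 1 = n)) t.2 p hp (hl t (by simp)) hL hκ
    obtain ⟨h2, hlen2⟩ := xsBnd_foldl P U hL hκ n l _ h1 (fun t' ht' => hl t' (by simp [ht']))
    refine ⟨?_, hlen2.trans hlen⟩
    have e : M + A + E + 3 + l.length * (A + E + 3) = M + (l.length + 1) * (A + E + 3) := by ring
    rw [List.length_cons, ← e]; exact h2

/-- Items of a coded level-record list are bounded by the code length. [folklore] -/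
theorem lrecBnd_of_mem {l : List (ℕ × ULevelRec)} {N : ℕ} (hN : (rawE (pairE natE lrecE) l).length ≤ N) :
    ∀ t ∈ l, LrecBnd N t.2 := by
  intro t ht
  have hitem := length_item_le_length_rawE (pairE natE lrecE) ht
  have hr : (lrecE t.2).length ≤ N := by
    have : (pairE natE lrecE t).length = 2 * (natE t.1).length + 2 + (lrecE t.2).length := by rw [pairE_apply, length_boolPair]
    omega
  have hN' : (vecE t.2.apexN).length ≤ N := by
    have := length_item_le_length_rawE strE (l := lrecFields t.2) (a := vecE t.2.apexN) (by simp [lrecFields])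
    change 2 * (vecE t.2.apexN).length + 2 ≤ (lrecE t.2).length at this
    omega
  have hD' : (natE t.2.apexD).length ≤ N := by
    have := length_item_le_length_rawE strE (l := lrecFields t.2) (a := natE t.2.apexD) (by simp [lrecFields])
    change 2 * (natE t.2.apexD).length + 2 ≤ (lrecE t.2).length at this
    omega
  refine ⟨natAbs_lt_of_mem_vec hN', ?_⟩
  calc t.2.apexD < 2 ^ Nat.size t.2.apexD := Nat.lt_size_self _
    _ ≤ 2 ^ N := Nat.pow_le_pow_right (by norm_num) (by rw [← length_natE]; exact hD')

/-- `L` and `κ` are bounded by the code length of the parameter record. [folklore] -/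
theorem params_le_length_L_κ (P : UParams) : P.L ≤ (paramsE P).length ∧ P.κ ≤ (paramsE P).length := by
  have h : (paramsE P).length = 2 * P.D + 2 + (2 * P.L + 2 + (2 * P.κ + 2 + (2 * P.W + 2 + (2 * P.bB + 2 + (2 * P.Wf + 2 + (2 * P.Wa + 2)))))) := by
    simp only [paramsE, paramsFields, rawE_cons, rawE_nil, length_boolPair, length_unE, List.length_nil]
  omega

/-- The context of the un-projection fold: `((P, 1ᵁ), |levels|, start)`. [folklore] -/
private abbrev XCtx : Type := ((UParams × ℕ) × ℕ) × (List ℤ × ℕ)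

/-- Its code. [folklore] -/
private abbrev xctxE : XCtx → List Bool := pairE (pairE (pairE paramsE unE) natE) (pairE vecE natE)

/-- **The un-projection pass `uxsGo` is computed in polynomial time** from `((P, 1ᵁ), levels, (N, R))`.
[cite: FournierKoiran2000, p. 11, §2.2] -/
theorem uxsGoFP : CodeFP (pairE (pairE paramsE unE) (pairE (rawE lrecE) (pairE vecE natE))) (pairE vecE natE)
    (fun q => uxsGo q.1.1 q.1.2 q.2.1 q.2.2) := by
  -- context `((P, U), n, p₀)` with `n = |levels|`, items `(i, r)`
  have hstep : CodeFP (pairE xctxE (pairE (pairE natE lrecE) (pairE vecE natE))) (pairE vecE natE)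
      (fun t : XCtx × (ℕ × ULevelRec) × (List ℤ × ℕ) => uxsStep t.1.1.1.1 t.1.1.1.2 (decide (t.2.1.1 + 1 = t.1.1.2)) t.2.1.2 t.2.2) :=
    (uxsStepFP.comp ((fst _ _).fst'.fst'.pair ((natEq.comp ((natAdd.comp ((snd _ _).fst'.fst'.pair (const _ 1))).pair
      (fst _ _).fst'.snd')).pair ((snd _ _).fst'.snd'.pair (snd _ _).snd'))) :)
  have hfold := foldl (σ := XCtx) (α := ℕ × ULevelRec) (β := List ℤ × ℕ) (eσ := xctxE) (eα := pairE natE lrecE) (eβ := pairE vecE natE)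
    (step := fun s t q => uxsStep s.1.1.1 s.1.1.2 (decide (t.1 + 1 = s.1.2)) t.2 q) (init := fun s => s.2) hstep (snd _ _)
    (60 * (X + 1) ^ 4) (fun s l₁ l₂ => by
      obtain ⟨⟨⟨P, U⟩, n⟩, p₀⟩ := s
      obtain ⟨N, hN⟩ : ∃ N, N = (pairE xctxE (rawE (pairE natE lrecE)) ((((P, U), n), p₀), l₁ ++ l₂)).length := ⟨_, rfl⟩
      have hlen : N = 2 * (2 * (2 * (2 * (paramsE P).length + 2 + (unE U).length) + 2 + (natE n).length) + 2 +
          (2 * (vecE p₀.1).length + 2 + (natE p₀.2).length)) + 2 + (rawE (pairE natE lrecE) (l₁ ++ l₂)).length := by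
        rw [hN]
        show (boolPair (boolPair (boolPair (boolPair (paramsE P) (unE U)) (natE n)) (boolPair (vecE p₀.1) (natE p₀.2)))
          (rawE (pairE natE lrecE) (l₁ ++ l₂))).length = _
        simp only [length_boolPair]
      rw [length_unE] at hlen
      have hPL := params_le_length_L_κ P
      have hp₀ : XsBnd N p₀ :=
        ⟨natAbs_lt_of_mem_vec (l := p₀.1) (by omega), lt_of_lt_of_le (Nat.lt_size_self _)
          (Nat.pow_le_pow_right (by norm_num) (by rw [← length_natE]; omega))⟩
      have hitems : ∀ t ∈ l₁, LrecBnd N t.2 := fun t ht =>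
        lrecBnd_of_mem (l := l₁ ++ l₂) (by omega) t (List.mem_append_left _ ht)
      have hE : P.L + 5 ≤ N * N + 5 ∧ P.κ * (U + 1) ≤ N * N + 5 := by
        constructor
        · nlinarith [hPL.1]
        · calc P.κ * (U + 1) ≤ N * N := Nat.mul_le_mul (by omega) (by omega)
            _ ≤ N * N + 5 := Nat.le_add_right _ _
      obtain ⟨hB, hL⟩ := xsBnd_foldl P U hE.1 hE.2 n l₁ p₀ hp₀ hitems
      have hl₁ : l₁.length ≤ N := by
        have := length_le_length_rawE (pairE natE lrecE) (l₁ ++ l₂)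
        rw [List.length_append] at this; omega
      set q := l₁.foldl (fun q t => uxsStep P U (decide (t.1 + 1 = n)) t.2 q) p₀ with hq
      have hM : N + l₁.length * (N + (N * N + 5) + 3) ≤ 3 * (N + 1) ^ 3 := by nlinarith
      have hq1 : (vecE q.1).length ≤ q.1.length * (6 * (3 * (N + 1) ^ 3) + 6) :=
        length_vecE_le fun a ha => lt_of_lt_of_le (hB.1 a ha) (Nat.pow_le_pow_right (by norm_num) hM)
      have hq2 : (natE q.2).length ≤ 3 * (N + 1) ^ 3 := by
        rw [length_natE]; exact (size_le_of_lt_two_pow hB.2).trans hM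
      have hq1' : q.1.length ≤ N := by
        have h := length_le_length_rawE intE p₀.1
        change p₀.1.length ≤ (vecE p₀.1).length at h
        omega
      rw [← hN, pairE_apply, length_boolPair]
      have : (60 * (X + 1) ^ 4 : Polynomial ℕ).eval N = 60 * (N + 1) ^ 4 := by simp
      rw [this]
      nlinarith [Nat.mul_le_mul hq1' (le_refl (6 * (3 * (N + 1) ^ 3) + 6))])
  refine ((hfold.comp ((((fst _ _).pair ((natLength lrecE).comp (snd _ _).fst')).pair (snd _ _).snd').pair
    ((rawEnum lrecE).comp (snd _ _).fst'))).congr fun q => ?_)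
  simp only
  rw [uxsGo_eq_foldl]

/-- **The located point `uxsOf P U levels` is computed in polynomial time** from `((P, 1ᵁ), levels)`.
[cite: FournierKoiran2000, p. 11] -/
theorem uxsOfFP : CodeFP (pairE (pairE paramsE unE) (rawE lrecE)) (pairE vecE natE) (fun q => uxsOf q.1.1 q.1.2 q.2) := by
  have hnil : CodeFP (pairE paramsE unE) (pairE vecE natE) (fun c => (List.replicate c.1.D (0 : ℤ), 1)) :=
    ((zeroVec.comp (params_D.comp (fst _ _))).pair (const _ 1) :)
  have hcons : CodeFP (pairE (pairE paramsE unE) (pairE lrecE (rawE lrecE))) (pairE vecE natE)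
      (fun t => uxsGo t.1.1 t.1.2 t.2.2 (t.2.1.apexN, t.2.1.apexD)) :=
    (uxsGoFP.comp ((fst _ _).pair ((snd _ _).snd'.pair ((lrec_apexN.comp (snd _ _).fst').pair (lrec_apexD.comp (snd _ _).fst')))) :)
  exact rawCases (k := fun (c : UParams × ℕ) (levels : List ULevelRec) => uxsOf c.1 c.2 levels) hnil hcons
    (fun _ => rfl) (fun _ _ _ => rfl)

end XStar

/-! ### The level parameters from the dimension -/

section Params

variable (T : Polynomial ℕ)

/-- `T(n)` in unary from `1ⁿ`. [folklore] -/
theorem polyUn : CodeFP unE unE (fun n => T.eval n) :=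
  ⟨Plumb.polyFn T, Plumb.polyFn_mem_FP T, fun n => by rw [Plumb.polyFn_apply, length_unE, unE_eq_ones]⟩

/-- `κOf n β` in unary from `(1ⁿ, 1ᵝ)`. [folklore] -/
theorem κOfFP : CodeFP (pairE unE unE) unE (fun p => κOf p.1 p.2) := by
  have hn : CodeFP (pairE unE unE) unE (fun p => p.1) := fst _ _
  have hβ : CodeFP (pairE unE unE) unE (fun p => p.2) := snd _ _
  exact ((unAdd.comp ((unAdd.comp ((unMul.comp ((unSucc.comp hn).pair (unSucc.comp hn))).pair
    (unMul.comp ((unAdd.comp (hβ.pair (const _ 2))).pair (unAdd.comp (hn.pair (const _ 2))))))).pair (const _ 6)) :)).congr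
    fun p => by simp only [κOf]

/-- `LOf n β` in unary. [folklore] -/
theorem LOfFP : CodeFP (pairE unE unE) unE (fun p => LOf p.1 p.2) := by
  have hn : CodeFP (pairE unE unE) unE (fun p => p.1) := fst _ _
  have hβ : CodeFP (pairE unE unE) unE (fun p => p.2) := snd _ _
  have h1 : CodeFP (pairE unE unE) unE (fun p => κOf p.1 p.2 * (p.1 + 2)) := (unMul.comp (κOfFP.pair (unAdd.comp (hn.pair (const _ 2)))) :)
  have h2 : CodeFP (pairE unE unE) unE (fun p => (p.1 + 1) * (p.1 + 1) + 3 * (p.1 + 1) + 2 + p.2 * (p.1 + 3)) :=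
    (unAdd.comp ((unAdd.comp ((unAdd.comp ((unMul.comp ((unSucc.comp hn).pair (unSucc.comp hn))).pair
      (unMul.comp ((const _ 3).pair (unSucc.comp hn))))).pair (const _ 2))).pair (unMul.comp (hβ.pair (unAdd.comp (hn.pair (const _ 3)))))) :)
  exact ((unAdd.comp (h1.pair h2) :)).congr fun p => by simp only [LOf]

/-- `WOf n β` in unary. [folklore] -/
theorem WOfFP : CodeFP (pairE unE unE) unE (fun p => WOf p.1 p.2) := by
  have hn : CodeFP (pairE unE unE) unE (fun p => p.1) := fst _ _
  have hβ : CodeFP (pairE unE unE) unE (fun p => p.2) := snd _ _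
  have hsq : CodeFP (pairE unE unE) unE (fun p => (p.1 + 1) * (p.1 + 1)) := (unMul.comp ((unSucc.comp hn).pair (unSucc.comp hn)) :)
  have hβn : CodeFP (pairE unE unE) unE (fun p => p.2 * (p.1 + 1)) := (unMul.comp (hβ.pair (unSucc.comp hn)) :)
  have h1 : CodeFP (pairE unE unE) unE (fun p => LOf p.1 p.2 + 1 + (p.1 + 1) * (p.1 + 1) + p.2 * (p.1 + 1)) :=
    (unAdd.comp ((unAdd.comp ((unSucc.comp LOfFP).pair hsq)).pair hβn) :)
  have h2 : CodeFP (pairE unE unE) unE (fun p => (p.1 + 1) * (p.1 + 1) + 2 * (p.1 + 1) + p.2 * (p.1 + 1) + p.2 + κOf p.1 p.2 * (p.1 + 1)) :=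
    (unAdd.comp ((unAdd.comp ((unAdd.comp ((unAdd.comp (hsq.pair (unMul.comp ((const _ 2).pair (unSucc.comp hn))))).pair hβn)).pair hβ)).pair
      (unMul.comp (κOfFP.pair (unSucc.comp hn)))) :)
  exact ((unAdd.comp ((unAdd.comp (h1.pair h2)).pair (const _ 2)) :)).congr fun p => by simp only [WOf]

/-- **The level parameters `paramsOf n (T(n)+1)`, untyped, are computed in polynomial time from `1ⁿ`.**
[cite: FournierKoiran2000, §2.1–2.2 (the choice of `r_n`; polynomial size of all parameters)] -/
theorem paramsOfFP : CodeFP unE paramsE (fun n => (paramsOf n (T.eval n + 1)).toU) := by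
  have hβ : CodeFP unE unE (fun n => T.eval n + 1) := (unSucc.comp (polyUn T) :)
  have hnβ : CodeFP unE (pairE unE unE) (fun n => (n, T.eval n + 1)) := (CodeFP.id unE).pair hβ
  have hD : CodeFP unE unE (fun n => n + 1) := unSucc
  have hL : CodeFP unE unE (fun n => LOf n (T.eval n + 1)) := (LOfFP.comp hnβ :)
  have hκ : CodeFP unE unE (fun n => κOf n (T.eval n + 1)) := (κOfFP.comp hnβ :)
  have hW : CodeFP unE unE (fun n => WOf n (T.eval n + 1)) := (WOfFP.comp hnβ :)
  have hbB : CodeFP unE unE (fun n => T.eval n + 1 + 1) := (unSucc.comp hβ :)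
  have hWf : CodeFP unE unE (fun n => (n + 1) * (T.eval n + 1 + 1 + 1)) := (unMul.comp (hD.pair (unSucc.comp hbB)) :)
  have hWa : CodeFP unE unE (fun n => WOf n (T.eval n + 1) + (n + 1) * (WOf n (T.eval n + 1) + 1)) :=
    (unAdd.comp (hW.pair (unMul.comp (hD.pair (unSucc.comp hW)))) :)
  have hrec : CodeFP unE (rawE unE) (fun n => [n + 1, LOf n (T.eval n + 1), κOf n (T.eval n + 1), WOf n (T.eval n + 1),
      T.eval n + 1 + 1, (n + 1) * (T.eval n + 1 + 1 + 1), WOf n (T.eval n + 1) + (n + 1) * (WOf n (T.eval n + 1) + 1)]) :=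
    ((rawCons unE).comp (hD.pair ((rawCons unE).comp (hL.pair ((rawCons unE).comp (hκ.pair ((rawCons unE).comp (hW.pair
      ((rawCons unE).comp (hbB.pair ((rawCons unE).comp (hWf.pair ((rawSingleton unE).comp hWa)))))))))))) :)
  obtain ⟨f, hf, hfr⟩ := hrec
  refine ⟨f, hf, fun n => ?_⟩
  rw [hfr]
  have hbB' : (paramsOf n (T.eval n + 1)).bB = T.eval n + 1 + 1 := by
    show Nat.size (2 ^ (T.eval n + 1)) = _; rw [Nat.size_pow]
  simp only [paramsE, paramsFields, LevelParams.toU, LevelParams.Wf, LevelParams.Wa, hbB', paramsOf_D, paramsOf_L, paramsOf_κ, paramsOf_W]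

/-- **The coefficient bound `2^{T(n)+1}` in binary from `1ⁿ`.** [cite: FournierKoiran2000, §2 Remark 1] -/
theorem boundOfFP : CodeFP unE natE (fun n => 2 ^ (T.eval n + 1)) :=
  (natPow.comp ((const unE 2).pair (unSucc.comp (polyUn T))) :)

end Params

end FKPointLocation

end Literature.Computability.Complexity
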